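import Mathlib.Data.List.GetD
import Summits.QuantumFields.GaugeBoot.Certificates.SparseReducedTrace
import HarnessLib

/-!
# Sparse certificate replay, part 4c: trace tables by ONE sweep over the block entries (no position lists)

HONEST FRAMING (cell `pub-gaugeboot`): certified bounds on lattice expectations at stated coupling,
gauge group, dimension and torus size; NOT a mass gap, NOT a continuum limit, NOT a string tension;
NOT Yang–Mills-summit-bearing (barriers `FixedCouplingUltralocality`, `PerturbativeInvisibility`).

`Certificates/SparseReducedTrace.lean` verifies the per-variable trace table `T[v] = 4^K Σ_k tr (Z_k F⁽ᵏ⁾_v)`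
through per-variable POSITION LISTS (`P2`; checks `shapeCheck`, `entCoverCheck`, `traceCheck`).  Their kernel cost grows
with `Σ_v |P_v|²` (cover) and with `positions × block dimension` (trace); for the large reduced families of the cell
(glyz-c2-4D: 151 019 positions; kz-L2-rp-4D: 897 944 positions, `|P_v| ≤ 3 093`) that is 10³–10⁴ s of kernel time.
This module computes ALL `T[v]` at once by a single sweep over the blocks' entry tables `EB` (every ordered entry
`(k, i, j)`, `i, j < m`, every term `(w, c)`: add `c · ⟨G_k[i], G_k[j]⟩` to the accumulator of `w`), the accumulators
held in a binary trie keyed by the bits of `w` (`Trie`, depth `d`, `2^d ≥ hi`), restricted to a variable window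
`lo ≤ w < hi` so that the work can be chunked, and then compares the trie with the emitted table `T` by one linear walk
(`sweepCheck`).  Soundness (`sweepOK_of_check`) gives exactly the integer identity that `sum_posTerm_eq` derives from
shape + cover + trace, so `objective_bound_sweep` is `objective_bound_red` with those three hypotheses replaced by
`SweepOK` — no `P2`, no shape, no cover.  All `[folklore]`; nothing is claimed about lattice gauge theory.
-/

namespace Summit.QuantumFields.GaugeBoot.Certificates.Sparse

open Matrix Finset Literature.Computation.Certificates

noncomputable section

/-! ## A binary trie of integer accumulators -/

/-- Binary trie with integer leaves (keys = bit strings of fixed length, least significant bit first). [folklore] -/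
inductive Trie where
  | nil : Trie
  | leaf : ℤ → Trie
  | node : Trie → Trie → Trie

namespace Trie

/-- Left subtree (or `nil`). [folklore] -/
def left : Trie → Trie
  | node l _ => l
  | _ => nil

/-- Right subtree (or `nil`). [folklore] -/
def right : Trie → Trie
  | node _ r => r
  | _ => nil

/-- The accumulator of key `w` at depth `d` (missing ⇒ `0`). [folklore] -/
def get : ℕ → Trie → ℕ → ℤ
  | _, nil, _ => 0
  | 0, leaf z, _ => z
  | 0, node _ _, _ => 0
  | _ + 1, leaf _, _ => 0
  | d + 1, node l r, w => if w % 2 = 0 then get d l (w / 2) else get d r (w / 2)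

/-- Add `c` to the accumulator of key `w` at depth `d`. [folklore] -/
def add : ℕ → Trie → ℕ → ℤ → Trie
  | 0, nil, _, c => leaf c
  | 0, leaf z, _, c => leaf (z + c)
  | 0, node _ _, _, c => leaf c
  | d + 1, t, w, c =>
      if w % 2 = 0 then node (add d t.left (w / 2) c) t.right else node t.left (add d t.right (w / 2) c)

/-- `left` of a node. [folklore] -/
@[simp] theorem left_node (l r : Trie) : (node l r).left = l := rfl

/-- `right` of a node. [folklore] -/
@[simp] theorem right_node (l r : Trie) : (node l r).right = r := rfl

/-- `add` one level down, even key. [folklore] -/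
theorem add_succ_even (d : ℕ) (t : Trie) (w : ℕ) (c : ℤ) (hw : w % 2 = 0) :
    add (d + 1) t w c = node (add d t.left (w / 2) c) t.right := by
  rw [add]; exact if_pos hw

/-- `add` one level down, odd key. [folklore] -/
theorem add_succ_odd (d : ℕ) (t : Trie) (w : ℕ) (c : ℤ) (hw : ¬ w % 2 = 0) :
    add (d + 1) t w c = node t.left (add d t.right (w / 2) c) := by
  rw [add]; exact if_neg hw

/-- `get` at depth `0` after `add`. [folklore] -/
theorem get_add_zero (t : Trie) (w v : ℕ) (c : ℤ) : get 0 (add 0 t w c) v = get 0 t v + c := by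
  cases t <;> simp [get, add]

/-- `get` of the left subtree. [folklore] -/
theorem get_left (d : ℕ) (t : Trie) (v : ℕ) (hv : v % 2 = 0) : get (d + 1) t v = get d t.left (v / 2) := by
  cases t <;> simp [get, left, hv]

/-- `get` of the right subtree. [folklore] -/
theorem get_right (d : ℕ) (t : Trie) (v : ℕ) (hv : ¬ v % 2 = 0) : get (d + 1) t v = get d t.right (v / 2) := by
  cases t <;> simp [get, right, hv]

/-- **Trie semantics**: for keys below `2^d`, `add` adds `c` to the accumulator of `w` and to no other. [folklore] -/
theorem get_add : ∀ (d : ℕ) (t : Trie) (w v : ℕ) (c : ℤ), w < 2 ^ d → v < 2 ^ d →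
    get d (add d t w c) v = get d t v + (if v = w then c else 0)
  | 0, t, w, v, c, hw, hv => by
    have hw0 : w = 0 := by omega
    have hv0 : v = 0 := by omega
    subst hw0; subst hv0
    simp [get_add_zero]
  | d + 1, t, w, v, c, hw, hv => by
    have hw2 : w / 2 < 2 ^ d := by rw [pow_succ] at hw; omega
    have hv2 : v / 2 < 2 ^ d := by rw [pow_succ] at hv; omega
    have key : (v = w) ↔ (v % 2 = w % 2 ∧ v / 2 = w / 2) := by
      constructor
      · rintro rfl; exact ⟨rfl, rfl⟩
      · rintro ⟨h1, h2⟩; rw [← Nat.div_add_mod v 2, ← Nat.div_add_mod w 2, h1, h2]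
    by_cases hw0 : w % 2 = 0
    · rw [add_succ_even d t w c hw0]
      by_cases hv0 : v % 2 = 0
      · rw [get_left d _ v hv0, get_left d t v hv0, left_node, get_add d t.left (w / 2) (v / 2) c hw2 hv2]
        congr 1
        simp [key, hv0, hw0]
      · rw [get_right d _ v hv0, get_right d t v hv0, right_node]
        have : ¬ v = w := fun h => hv0 (h ▸ hw0)
        simp [this]
    · rw [add_succ_odd d t w c hw0]
      by_cases hv0 : v % 2 = 0
      · rw [get_left d _ v hv0, get_left d t v hv0, left_node]
        have : ¬ v = w := fun h => hw0 (h ▸ hv0)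
        simp [this]
      · rw [get_right d _ v hv0, get_right d t v hv0, right_node, get_add d t.right (w / 2) (v / 2) c hw2 hv2]
        congr 1
        have hvm : v % 2 = 1 := by omega
        have hwm : w % 2 = 1 := by omega
        simp [key, hvm, hwm]

end Trie

/-! ## The sweep -/

/-- Factor row `i` of block `k`. [folklore] -/
def grow (GB : List (List (List ℤ))) (k i : ℕ) : List ℤ := (GB.getD k []).getD i []

/-- Add `c · wt` to the accumulator of every term `(w, c)` with `lo ≤ w < hi`. [folklore] -/
def accTerms (d lo hi : ℕ) (wt : ℤ) : List (ℕ × ℤ) → Trie → Trie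
  | [], t => t
  | (w, c) :: rest, t =>
      accTerms d lo hi wt rest (if lo ≤ w ∧ w < hi then t.add d w (c * wt) else t)

/-- Columns `j < n` of row `i` of block `k`: entry `ent EB k j i`, weight `⟨G_k[i], G_k[j]⟩`. [folklore] -/
def accJ (GB : List (List (List ℤ))) (EB : List (List (List (List (ℕ × ℤ))))) (d lo hi k i : ℕ) :
    ℕ → Trie → Trie
  | 0, t => t
  | j + 1, t => accJ GB EB d lo hi k i j (accTerms d lo hi (listDot (grow GB k i) (grow GB k j)) (ent EB k j i) t)

/-- Rows `i < n` of block `k` (all `m` columns each). [folklore] -/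
def accI (GB : List (List (List ℤ))) (EB : List (List (List (List (ℕ × ℤ))))) (d lo hi m k : ℕ) :
    ℕ → Trie → Trie
  | 0, t => t
  | i + 1, t => accI GB EB d lo hi m k i (accJ GB EB d lo hi k i m t)

/-- Blocks `k < n` (all `m × m` entry positions each). [folklore] -/
def accK (GB : List (List (List ℤ))) (EB : List (List (List (List (ℕ × ℤ))))) (d lo hi m : ℕ) :
    ℕ → Trie → Trie
  | 0, t => t
  | k + 1, t => accK GB EB d lo hi m k (accI GB EB d lo hi m k m t)

/-- The sweep over `nb` blocks: accumulators of the variables `lo ≤ w < hi`. [folklore] -/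
def sweep (GB : List (List (List ℤ))) (EB : List (List (List (List (ℕ × ℤ))))) (nb m d lo hi : ℕ) : Trie :=
  accK GB EB d lo hi m nb Trie.nil

/-- The windowed position sum of variable `v`: `[lo ≤ v < hi] · Σ_{k<nb} Σ_{i<m} Σ_{j<m} posTerm v (k,i,j)` — as
range sums. [folklore] -/
def winSum (GB : List (List (List ℤ))) (EB : List (List (List (List (ℕ × ℤ))))) (lo hi : ℕ) (v : ℕ)
    (nb m : ℕ) : ℤ :=
  if lo ≤ v ∧ v < hi then
    ∑ k ∈ Finset.range nb, ∑ i ∈ Finset.range m, ∑ j ∈ Finset.range m, posTerm GB EB v (k, i, j)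
  else 0

/-- Semantics of `accTerms`: the accumulator of `v` gains `[lo ≤ v < hi] · coef L v · wt`. [folklore] -/
theorem get_accTerms (d lo hi : ℕ) (hd : hi ≤ 2 ^ d) (wt : ℤ) (v : ℕ) (hv : v < 2 ^ d) :
    ∀ (L : List (ℕ × ℤ)) (t : Trie), (accTerms d lo hi wt L t).get d v =
      t.get d v + (if lo ≤ v ∧ v < hi then coef L v * wt else 0)
  | [], t => by simp [accTerms, coef]
  | (w, c) :: rest, t => by
    rw [accTerms, get_accTerms d lo hi hd wt v hv rest]
    have hcoef : coef ((w, c) :: rest) v = (bif w == v then c else 0) + coef rest v := rfl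
    rw [hcoef]
    by_cases hw : lo ≤ w ∧ w < hi
    · rw [if_pos hw, Trie.get_add d t w v _ (lt_of_lt_of_le hw.2 hd) hv]
      by_cases hvw : v = w
      · subst hvw
        rw [if_pos rfl, if_pos hw, if_pos hw, beq_self_eq_true, cond_true]; ring
      · have hb : (w == v) = false := by rw [beq_eq_false_iff_ne]; exact Ne.symm hvw
        rw [if_neg hvw, hb, cond_false, zero_add, add_zero]
    · rw [if_neg hw]
      by_cases hvr : lo ≤ v ∧ v < hi
      · have hb : (w == v) = false := by
          rw [beq_eq_false_iff_ne]; rintro rfl; exact hw hvr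
        rw [hb, cond_false, zero_add]
      · rw [if_neg hvr, if_neg hvr]

/-- Semantics of `accJ`. [folklore] -/
theorem get_accJ (GB : List (List (List ℤ))) (EB : List (List (List (List (ℕ × ℤ))))) (d lo hi : ℕ)
    (hd : hi ≤ 2 ^ d) (k i v : ℕ) (hv : v < 2 ^ d) :
    ∀ (n : ℕ) (t : Trie), (accJ GB EB d lo hi k i n t).get d v =
      t.get d v + (if lo ≤ v ∧ v < hi then ∑ j ∈ Finset.range n, posTerm GB EB v (k, i, j) else 0)
  | 0, t => by simp [accJ]
  | n + 1, t => by
    rw [accJ, get_accJ GB EB d lo hi hd k i v hv n, get_accTerms d lo hi hd _ v hv]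
    by_cases hr : lo ≤ v ∧ v < hi
    · simp only [if_pos hr, Finset.sum_range_succ, posTerm, grow]
      ring
    · simp [if_neg hr]

/-- Semantics of `accI`. [folklore] -/
theorem get_accI (GB : List (List (List ℤ))) (EB : List (List (List (List (ℕ × ℤ))))) (d lo hi : ℕ)
    (hd : hi ≤ 2 ^ d) (m k v : ℕ) (hv : v < 2 ^ d) :
    ∀ (n : ℕ) (t : Trie), (accI GB EB d lo hi m k n t).get d v =
      t.get d v + (if lo ≤ v ∧ v < hi then
        ∑ i ∈ Finset.range n, ∑ j ∈ Finset.range m, posTerm GB EB v (k, i, j) else 0)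
  | 0, t => by simp [accI]
  | n + 1, t => by
    rw [accI, get_accI GB EB d lo hi hd m k v hv n, get_accJ GB EB d lo hi hd k n v hv]
    by_cases hr : lo ≤ v ∧ v < hi
    · simp only [if_pos hr, Finset.sum_range_succ]; ring
    · simp [if_neg hr]

/-- Semantics of `accK`. [folklore] -/
theorem get_accK (GB : List (List (List ℤ))) (EB : List (List (List (List (ℕ × ℤ))))) (d lo hi : ℕ)
    (hd : hi ≤ 2 ^ d) (m v : ℕ) (hv : v < 2 ^ d) :
    ∀ (n : ℕ) (t : Trie), (accK GB EB d lo hi m n t).get d v = t.get d v + winSum GB EB lo hi v n m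
  | 0, t => by simp [accK, winSum]
  | n + 1, t => by
    rw [accK, get_accK GB EB d lo hi hd m v hv n, get_accI GB EB d lo hi hd m n v hv]
    by_cases hr : lo ≤ v ∧ v < hi
    · simp only [winSum, if_pos hr, Finset.sum_range_succ]; ring
    · simp [winSum, if_neg hr]

/-- **Sweep semantics**: the accumulator of `v` is its windowed position sum. [folklore] -/
theorem get_sweep (GB : List (List (List ℤ))) (EB : List (List (List (List (ℕ × ℤ))))) (nb m d lo hi : ℕ)
    (hd : hi ≤ 2 ^ d) (v : ℕ) (hv : v < 2 ^ d) :
    (sweep GB EB nb m d lo hi).get d v = winSum GB EB lo hi v nb m := by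
  rw [sweep, get_accK GB EB d lo hi hd m v hv]
  simp [Trie.get]

/-! ## Comparing the sweep with the emitted table -/

/-- Linear walk: `get v = x_v` for the next `n` variables, `xs` = the table from index `v` on
(exhausted table ⇒ entries `0`). [folklore] -/
def checkT (d : ℕ) (tr : Trie) : List ℤ → ℕ → ℕ → Bool
  | _, _, 0 => true
  | [], v, n + 1 => (tr.get d v == 0) && checkT d tr [] (v + 1) n
  | x :: xs, v, n + 1 => (tr.get d v == x) && checkT d tr xs (v + 1) n

/-- Soundness of `checkT` against `T.drop v`. [folklore] -/
theorem checkT_sound (d : ℕ) (tr : Trie) (T : List ℤ) :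
    ∀ (n v : ℕ), checkT d tr (T.drop v) v n = true → ∀ u, v ≤ u → u < v + n → tr.get d u = T.getD u 0
  | 0, v, _, u, h1, h2 => by omega
  | n + 1, v, h, u, h1, h2 => by
    have hstep : tr.get d v = T.getD v 0 ∧ checkT d tr (T.drop (v + 1)) (v + 1) n = true := by
      by_cases hv : v < T.length
      · rw [List.drop_eq_getElem_cons hv, checkT, Bool.and_eq_true, beq_iff_eq] at h
        rw [List.getD_eq_getElem T 0 hv]; exact h
      · rw [not_lt] at hv
        rw [List.drop_of_length_le hv, checkT, Bool.and_eq_true, beq_iff_eq] at h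
        rw [List.getD_eq_default T 0 hv, List.drop_of_length_le (by omega)]
        exact h
    rcases Nat.eq_or_lt_of_le h1 with rfl | hlt
    · exact hstep.1
    · exact checkT_sound d tr T n (v + 1) hstep.2 u hlt (by omega)

/-- **Sweep check** for the variable window `lo ≤ v < hi`: one sweep, one linear comparison with `T`. [folklore] -/
def sweepCheck (GB : List (List (List ℤ))) (EB : List (List (List (List (ℕ × ℤ))))) (nb m d : ℕ)
    (T : List ℤ) (lo hi : ℕ) : Bool :=
  decide (hi ≤ 2 ^ d) && checkT d (sweep GB EB nb m d lo hi) (T.drop lo) lo (hi - lo)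

/-- What `sweepCheck` establishes: `T[v]` is the full position sum of `v`, `lo ≤ v < hi`. [folklore] -/
def SweepOK (GB : List (List (List ℤ))) (EB : List (List (List (List (ℕ × ℤ))))) (nb m : ℕ) (T : List ℤ)
    (lo hi : ℕ) : Prop :=
  ∀ v, lo ≤ v → v < hi →
    ∑ k : Fin nb, ∑ i : Fin m, ∑ j : Fin m, posTerm GB EB v (k.val, i.val, j.val) = T.getD v 0

/-- Soundness of `sweepCheck`. [folklore] -/
theorem sweepOK_of_check {GB : List (List (List ℤ))} {EB : List (List (List (List (ℕ × ℤ))))} {nb m d : ℕ}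
    {T : List ℤ} {lo hi : ℕ} (h : sweepCheck GB EB nb m d T lo hi = true) : SweepOK GB EB nb m T lo hi := by
  rw [sweepCheck, Bool.and_eq_true, decide_eq_true_eq] at h
  obtain ⟨hd, hc⟩ := h
  intro v hlo hhi
  have hv : v < 2 ^ d := lt_of_lt_of_le hhi hd
  have hget := checkT_sound d _ T (hi - lo) lo hc v hlo (by omega)
  rw [get_sweep GB EB nb m d lo hi hd v hv, winSum, if_pos ⟨hlo, hhi⟩] at hget
  rw [← hget, ← Fin.sum_univ_eq_sum_range]
  refine Finset.sum_congr rfl fun k _ => ?_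
  rw [← Fin.sum_univ_eq_sum_range]
  refine Finset.sum_congr rfl fun i _ => ?_
  rw [← Fin.sum_univ_eq_sum_range]

/-- Concatenating variable windows. [folklore] -/
theorem SweepOK.append {GB : List (List (List ℤ))} {EB : List (List (List (List (ℕ × ℤ))))} {nb m : ℕ}
    {T : List ℤ} {lo mid hi : ℕ} (h1 : SweepOK GB EB nb m T lo mid) (h2 : SweepOK GB EB nb m T mid hi) :
    SweepOK GB EB nb m T lo hi :=
  fun v hlo hhi => if hm : v < mid then h1 v hlo hm else h2 v (Nat.le_of_not_lt hm) hhi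

/-! ## The summed trace identity and the assembled bound, sweep form -/

/-- **Summed trace identity** from the sweep: `Σ_k tr (Z_k/4^K · F⁽ᵏ⁾_v) = T[v] / 4^K`. [folklore] -/
theorem sum_trace_zr_mul_fzE_of_sweep {GB : List (List (List ℤ))} {EB : List (List (List (List (ℕ × ℤ))))}
    {nb m nv : ℕ} {T : List ℤ} (K : ℕ) (hsw : SweepOK GB EB nb m T 0 nv) (v : Fin nv) :
    ∑ k : Fin nb, trace (zr (GB.getD k.val []) m K * (fzE EB k.val m v.val).map (Int.cast : ℤ → ℝ)) =
      ((T.getD v.val 0 : ℤ) : ℝ) / 4 ^ K := by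
  have hterm : ∀ (k : Fin nb) (i j : Fin m),
      zr (GB.getD k.val []) m K i j * ((fzE EB k.val m v.val).map (Int.cast : ℤ → ℝ)) j i =
        ((posTerm GB EB v.val (k.val, i.val, j.val) : ℤ) : ℝ) / 4 ^ K := by
    intro k i j
    simp only [zr, zmat, fzE, posTerm, Matrix.smul_apply, Matrix.map_apply, Matrix.of_apply,
      smul_eq_mul]
    push_cast
    ring
  simp only [Matrix.trace, Matrix.diag_apply, Matrix.mul_apply, hterm]
  rw [← hsw v.val (Nat.zero_le _) v.isLt]
  push_cast
  simp only [Finset.sum_div]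

/-- **Certified lower bound on the objective, reduced-block SWEEP form**: `objective_bound_red` with the position-list
hypotheses (`ShapeOK`, `EntCoverOK`, `TraceOK`) replaced by the single sweep statement `SweepOK GB EB nb m T 0 (nv+1)`.
[folklore] -/
theorem objective_bound_sweep {nv ne nb m K : ℕ} (cL : List (ℕ × ℚ)) (LM : List ℚ)
    (RW : List (ℚ × List (ℕ × ℚ))) (GB : List (List (List ℤ)))
    (EB : List (List (List (List (ℕ × ℤ))))) (dimL : List ℕ)
    (T : List ℤ) (R : List ℚ) (lower : ℚ)
    (hLM : LM.length ≤ ne) (hres : ResidOK₂ cL LM RW [(K, T)] R 0 (nv + 1))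
    (hfin : finalCheck₂ LM RW R (nv + 1) lower = true)
    (hlen : lenCheckAll GB m nb = true) (hdim : dimCheck EB dimL m nb = true)
    (hsw : SweepOK GB EB nb m T 0 (nv + 1))
    {y : Fin (nv + 1) → ℝ} (hy0 : y 0 = 1) (hρ : ∀ v : Fin (nv + 1), v ≠ 0 → |y v| ≤ 1)
    (heq : ∀ e : Fin ne, ∑ v : Fin (nv + 1),
      ((sget (RW.getD e.val dRow₂).2 v.val : ℚ) : ℝ) * y v = (((RW.getD e.val dRow₂).1 : ℚ) : ℝ))
    (hpsd : ∀ k : Fin nb, (redE EB k.val (dimL.getD k.val 0) (nv + 1) y).PosSemidef) :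
    ((lower : ℚ) : ℝ) ≤ ∑ v : Fin (nv + 1), ((sget cL v.val : ℚ) : ℝ) * y v :=
  objective_bound₂ cL LM RW [(K, T)] R lower hLM hres hfin (K := Fin nb) (σ := fun _ => Fin m)
    (fun k v => (fzE EB k.val m v.val).map (Int.cast : ℤ → ℝ))
    (fun k => zr (GB.getD k.val []) m K) (fun k => zr_posSemidef K (lenCheck_of_all hlen k))
    (fun v => by rw [sum_trace_zr_mul_fzE_of_sweep K hsw v, traceTerm_single]) hy0 hρ heq
    (fun k => posSemidef_gramE_of_redE hdim k.isLt (hpsd k))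

end

end Summit.QuantumFields.GaugeBoot.Certificates.Sparse
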